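import Summits.CriticalPhenomena.PercolationContinuityZ3.Theorems.PercNearOneGluingNoHeavyLowerTailOneCutBlobsAllPairsHeavy
import HarnessLib

/-!
# Blob structures with a majority blob: the one-cut bound reduces to event-form additive gluing

Support file for the crux `NoHeavyLowerTail` (stmt-CriticalPhenomena-4575; routes `PercNearOneGluing`,
`PercNearOneGluingNoHeavy`), BLOB-QUOTIENT analysis of the one-cut engine (depth prover nh-dp-blobmono),
continuing `…OneCutThreeBlobs.lean`, `…OneCutFourBlobs*.lean`, `…OneCutBlobsAllPairsHeavy.lean`.

Setting as there (`μ = prodBernoulli w` on `Fin n`, relays `A`, observer `o`, `N`, `E N`, minority event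
`B = {1 ≤ N < E N/2}`, blob structure `cls : Fin n → Fin b` on `insert o A`, masses `m_i`).  A MAJORITY blob is
a relay blob `l` with `m_l ≥ E N/2`; on the good set the minority event never reaches it.

* If the observer's blob carries a relay, a majority blob is in particular heavy and `…OneCutFourBlobs.lean`'s
  `oneCut_of_blobs_heavy` gives the bound (single cut), for any number of blobs.
* In general (`oneCut_of_blobs_majority_of_eventGluing`, this file, ANY number of blobs; the observer-free case
  is the one with content): with `y` a relay of the majority blob and `R'` a transversal of the other relay blobs,
  `B ⊆ {o ↮ y} ∩ ⋃_{r ∈ R'} {o ↔ r}` up to a null set, so the bound follows from the EVENT-FORM ADDITIVE GLUING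
  inequality, taken as an explicit HYPOTHESIS (CONDITIONAL result):

    (EG)  for all finite `A'`, `c`, `s`: (∀ a ∈ A', μ{a ↮ c} ≤ s) ⇒ μ({o ↮ c} ∩ ⋃_{a∈A'} {o ↔ a}) ≤ s.

  (EG) with `|A'| ≤ 2` is PROVED (`Theorems.lonelyOrPair_le`, from the tripod exchange inequality C⁺ — this is
  Kozma–Nitzan's `|A| = 2` case in sharp form), which is how the four-blob observer-free case was closed; (EG)
  implies the sibling crux `AdditiveGluing` (stmt-CriticalPhenomena-4576) since
  `μ(o↔A') − μ(o↔c) ≤ μ({o↮c} ∩ {o↔A'})`, and is open from `|A'| = 3` on (no violation in 3·10⁵ random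
  weighted graphs on ≤ 7 vertices, crux notes R4A-RESIDUAL.md).

So for blob structures WITH a majority blob the one-cut engine is exactly event-form Kozma–Nitzan gluing with
`b − 2` relays; WITHOUT a majority blob (many small blobs) it is the engine itself on the quotient.
-/

noncomputable section

namespace Summit.CriticalPhenomena.PercolationContinuityZ3.Theorems

open MeasureTheory Set Literature.Probability.LatticeModels Literature.Probability.Percolation
open scoped Classical BigOperators

variable {n : ℕ}

/-- **Blob structure with a majority blob: one-cut bound from event-form additive gluing (CONDITIONAL).**
Hypothesis (EG) for the given weighted graph and observer: for every finite relay set `A'`, target `c` and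
`s`, if `μ{a ↮ c} ≤ s` for all `a ∈ A'` then `μ({o ↮ c} ∩ ⋃_{a ∈ A'} {o ↔ a}) ≤ s`.  Conclusion: for every
blob structure `cls : Fin n → Fin b` on `insert o A` (any number of blobs) with a relay `y` whose blob is a
majority blob (`m_{cls y} ≥ E N/2`), the one-cut bound holds with constant `1`.  ((EG) is used with `A'` = a
transversal of the other relay blobs and `c` = the representative of `y`'s blob; for `|A'| ≤ 2` it is the
proved `lonelyOrPair_le`; when the observer's blob carries a relay the bound is unconditional anyway,
`oneCut_of_blobs_heavy`.) [folklore] -/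
theorem oneCut_of_blobs_majority_of_eventGluing {b : ℕ} (w : Sym2 (Fin n) → unitInterval)
    (A : Finset (Fin n)) (o : Fin n) (t : ℝ)
    (hEG : ∀ (A' : Finset (Fin n)) (c : Fin n) (s : ℝ),
      (∀ a ∈ A', (prodBernoulli w).real (openConn a c)ᶜ ≤ s) →
      (prodBernoulli w).real ((openConn o c)ᶜ ∩ ⋃ a ∈ A', openConn o a) ≤ s)
    (cls : Fin n → Fin b)
    (hcls : ∀ u ∈ insert o A, ∀ v ∈ insert o A, cls u = cls v →
      (prodBernoulli w).real (openConn u v)ᶜ = 0)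
    {y : Fin n} (hy : y ∈ A)
    (hmaj : (∑ a ∈ A, (prodBernoulli w).real (openConn o a)) / 2 ≤ ((A.filter fun a => cls a = cls y).card : ℝ))
    (hpair : ∀ a ∈ A, ∀ a' ∈ A, a ≠ a' → (prodBernoulli w).real (openConn a a')ᶜ ≤ t) :
    (prodBernoulli w).real {ω : BondConfig (Fin n) |
        1 ≤ (A.filter fun a => ω ∈ openConn o a).card ∧
        ((A.filter fun a => ω ∈ openConn o a).card : ℝ) <
          (∑ a ∈ A, (prodBernoulli w).real (openConn o a)) / 2} ≤ t := by
  set μ := prodBernoulli w with hμ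
  -- a transversal of the relay blobs, and the representative `ry` of `y`'s blob
  obtain ⟨R, hRA, hRinj, hRcov⟩ := exists_blob_transversal A cls
  obtain ⟨ry, hry, hcry⟩ := hRcov y hy
  set R' := R.erase ry with hR'
  have hE : μ.real ((openConn o ry)ᶜ ∩ ⋃ a ∈ R', openConn o a) ≤ t :=
    hEG R' ry t fun a ha =>
      hpair a (hRA (Finset.mem_of_mem_erase ha)) ry (hRA hry) (Finset.ne_of_mem_erase ha)
  refine oneCut_of_blobs_trap w A o t cls hcls _ ((openConn o ry)ᶜ ∩ ⋃ a ∈ R', openConn o a)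
    (fun ω hω => ?_) hE
  obtain ⟨⟨h1, hNlt⟩, hωG⟩ := hω
  -- the majority blob is never reached on the minority event
  have hmiss : ∀ z ∈ A, cls z = cls y → ¬ (openGraph ω).Reachable o z := by
    intro z hz hcz hoz
    have hge := blobs_count_ge_one A o cls ω hωG hz hoz
    have hge' : ((A.filter fun a => cls a = cls y).card : ℝ) ≤
        ((A.filter fun a => ω ∈ openConn o a).card : ℝ) := by rw [← hcz]; exact_mod_cast hge
    linarith
  refine ⟨hmiss ry (hRA hry) hcry, ?_⟩
  -- some relay is reached; its representative lies in `R'`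
  obtain ⟨d, hd⟩ := Finset.card_pos.1 h1
  obtain ⟨hdA, hod⟩ := Finset.mem_filter.1 hd
  obtain ⟨r, hr, hcr⟩ := hRcov d hdA
  have hor : (openGraph ω).Reachable o r :=
    hod.trans (hωG d (Finset.mem_insert_of_mem hdA) r (Finset.mem_insert_of_mem (hRA hr)) hcr.symm)
  have hrne : r ≠ ry := fun h => hmiss r (hRA hr) (by rw [h, hcry]) hor
  simp only [Set.mem_iUnion]
  exact ⟨r, Finset.mem_erase.2 ⟨hrne, hr⟩, hor⟩

/-- The hypothesis (EG) of `oneCut_of_blobs_majority_of_eventGluing` holds for relay sets of size at most two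
(Kozma–Nitzan's `|A| = 2` case in sharp event form, `Theorems.lonelyOrPair_le` from C⁺); hence every
observer-free blob structure with a majority blob and AT MOST TWO other relay blobs obeys the one-cut bound —
a restatement of the four-blob observer-free case useful as a sanity check of (EG)'s shape. [folklore] -/
theorem eventGluing_card_le_two (w : Sym2 (Fin n) → unitInterval) (o : Fin n) (A' : Finset (Fin n))
    (hA' : A'.card ≤ 2) (c : Fin n) (s : ℝ) (hs : 0 ≤ s)
    (hcut : ∀ a ∈ A', (prodBernoulli w).real (openConn a c)ᶜ ≤ s) :
    (prodBernoulli w).real ((openConn o c)ᶜ ∩ ⋃ a ∈ A', openConn o a) ≤ s := by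
  set μ := prodBernoulli w with hμ
  -- write `A' ⊆ {a, b}` for suitable `a, b ∈ A'` (or handle the empty set)
  by_cases hne : A'.Nonempty
  · obtain ⟨a, ha⟩ := hne
    -- a second element if any, else `b = a`
    have hex : ∃ b ∈ A', ∀ d ∈ A', d = a ∨ d = b := by
      by_cases h2 : ∃ b ∈ A', b ≠ a
      · obtain ⟨b, hb, hba⟩ := h2
        refine ⟨b, hb, fun d hd => ?_⟩
        by_contra hnot
        push Not at hnot
        have h3 : 2 < A'.card := by
          have : ({a, b, d} : Finset (Fin n)) ⊆ A' := by
            intro x hx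
            simp only [Finset.mem_insert, Finset.mem_singleton] at hx
            rcases hx with rfl | rfl | rfl
            · exact ha
            · exact hb
            · exact hd
          have hcard : ({a, b, d} : Finset (Fin n)).card = 3 := by
            rw [Finset.card_insert_of_notMem, Finset.card_insert_of_notMem, Finset.card_singleton]
            · simp only [Finset.mem_singleton]; exact fun h => hnot.2 h.symm
            · simp only [Finset.mem_insert, Finset.mem_singleton, not_or]
              exact ⟨hba.symm, fun h => hnot.1 h.symm⟩
          have := Finset.card_le_card this
          omega
        omega
      · push Not at h2
        exact ⟨a, ha, fun d hd => Or.inl (h2 d hd)⟩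
    obtain ⟨b, hb, hab⟩ := hex
    calc μ.real ((openConn o c)ᶜ ∩ ⋃ d ∈ A', openConn o d)
        ≤ μ.real ((openConn o c)ᶜ ∩ (openConn o a ∪ openConn o b)) := by
          refine measureReal_mono fun ω hω => ?_
          simp only [Set.mem_inter_iff, Set.mem_iUnion, Set.mem_union] at hω ⊢
          obtain ⟨hoc, d, hd, hod⟩ := hω
          rcases hab d hd with rfl | rfl
          · exact ⟨hoc, Or.inl hod⟩
          · exact ⟨hoc, Or.inr hod⟩
      _ ≤ s := lonelyOrPair_le w o a b c s (hcut a ha) (hcut b hb)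
  · rw [Finset.not_nonempty_iff_eq_empty] at hne
    subst hne
    simp only [Finset.notMem_empty, Set.iUnion_of_empty, Set.iUnion_empty, Set.inter_empty,
      measureReal_empty]
    exact hs

end Summit.CriticalPhenomena.PercolationContinuityZ3.Theorems

end
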